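import Summits.SmoothPoincare4.SmoothPoincare4.Theorems.CylinderEntropyCylinderRungTwoKillingFluxDefs
import Summits.SmoothPoincare4.SmoothPoincare4.Theorems.CylinderEntropyCylinderRungTwoFiniteTimeHalfOfCrux
import Literature.Geometry.Riemannian.LowEntropyHypersurfacesFourNeckSurgery
import Literature.Geometry.Riemannian.SphericalCylinderEntropy
import Literature.Geometry.Manifold.CylinderSlice
import Literature.Topology.FourManifolds.HomotopyS4CompactProofs
import HarnessLib

/-!
# Route `CylinderEntropy`, crux `CylinderRungTwo` (stmt-SmoothPoincare4-7631), line `killing-flux`: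
# vocabulary of the FINITE-TIME HALF — mean curvature flow with neck surgery IN THE CYLINDER `N = S⁴ × ℝ`

Route-posited objects (D-0016 `<Route>Defs` file, second vocabulary file of the line after
`CylinderEntropyCylinderRungTwoKillingFluxDefs.lean`) used by the registered stub `stub_cylinderSurgeryFlow`
of the checked skeleton `Cruxes/CylinderRungTwo/Lines/killing_flux.lean` (lead reshape r15) and by the
`Theorems/` files that compose it.  Everything here is a `Prop`-valued PREDICATE with explicit parameters
over existing tree declarations, or a PROVED theorem; nothing is asserted and no closed proposition is
defined.

Why (lead c5, 2026-08-17).  Up to r14 the finite-time half of the crux was ONE registered stub,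
`stub_finiteTimeHalf`: "mean curvature flow with surgery in `N` (Chodosh–Mantoulidis–Schulze generic
perturbation below `4/e` + Daniels-Holgate neck surgery, ported from `ℝ⁵` to `N`) ends in an immortal smooth
flow OF `M` ITSELF".  Its intended proof does not prove that statement: the surgery produces a TREE of
components, the separating survivors `P₁, …, P_k` are connected summands of `M`, and identifying a survivor
with `M` already needs the immortal analysis of every `Pᵢ`.  The honest cut is the one the tree uses for the
Euclidean theorem (`Literature.Geometry.Riemannian.MCFNeckSurgeryResolvable`,
`LowEntropyHypersurfacesFourNeckSurgery.lean`: the slice at a stopping time is resolved by finitely many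
further flows, neck replacements and discardings, an inductive predicate over which the topology is an
induction): record the surgery structure, with one more kind of leaf — a component that flows smoothly
FOREVER as a thin end-separating cross-section — and leave the recognition of those leaves to the immortal
half of the line.

* `IsCylinderMCFOn M F ν T₀ T₁` — a smooth mean curvature flow of embedded cross-sections of `N` on the
  compact interval `[T₀, T₁]` (the eight clauses of `IsCylinderMCF`, quantified over `t ∈ [T₀, T₁]`): the
  smooth flows between two stopping times.
* `CylNeckSurgeryResolvable M κ` — **the slice `κ : M → ℝ⁶` at a stopping time of a mean curvature flow with
  neck surgery in `N` is resolved**, the smallest predicate closed under: `discard` (the component is a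
  discarded one, `Literature.Geometry.Riemannian.IsMCFDiscardedComponent M`: `M ≅ S⁴` or `S³ × S¹` — round
  points and the discarded caps / tubes of Daniels-Holgate Thm. 2.29); `flow` (a flow `IsCylinderMCFOn` runs
  from the slice to the next stopping time, whose slice is resolved); `of_diffeomorph` (reparametrisation);
  `cut` / `cutNonseparating` (a neck `ψ : S³ × ℝ ↪ M` is replaced by two standard caps: the canonically capped
  sides `NeckCapData.Capped`, resp. the double cap `DoubleCap.M`, with new slices, are resolved — verbatim
  the constructors of the Euclidean predicate); and the NEW leaf `immortal` (an immortal smooth flow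
  `IsCylinderMCF M F ν T` of embedded cross-sections of the compact connected `M`, every slice separating the
  ends with cylinder entropy `< 2`, runs from the slice `F T`: the ROOT components, which by the area floor
  never vanish).  Only what the topological argument and the immortal analysis consume is recorded.
* PROVED API (non-vacuity): `IsCylinderMCF.isCylinderMCFOn` (restriction), `isCylinderMCFOn_staticSlice`,
  `CylNeckSurgeryResolvable.of_nonempty_diffeomorph_sphere`, `cylNeckSurgeryResolvable_staticSlice` (the
  static slice flow of `S⁴` is an immortal leaf: slices are calibrated, `λ_cyl ≤ 1 < 2`, and separate the
  ends) and `cylNeckSurgeryResolvable_staticSlice_flow` (… also after flowing statically for one unit of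
  time), `stub_cylNeckSurgeryResolvable_staticSlice` (registered anchor).

References: O. Chodosh, C. Mantoulidis, F. Schulze, *Mean curvature flow with generic low-entropy initial
data II*, Duke Math. J. 174 (2025), arXiv:2309.03856, Cor. 1.5 (b), Thm. 1.13; J. M. Daniels-Holgate,
*Approximation of mean curvature flow with generic singularities by smooth flows with surgery*, Adv. Math.
410 (2022), Thm. 1.3, §2.1 Def. 2.18–2.20, Def. 2.26, Thm. 2.29; R. Haslhofer, B. Kleiner, *Mean curvature
flow with surgery*, Duke Math. J. 166 (2017), Def. 27, Def. 29; R. S. Hamilton, Comm. Anal. Geom. 5 (1997)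
§1.1 (the surgery programme); B. White, *The size of the singular set in mean curvature flow of mean-convex
sets*, J. Amer. Math. Soc. 13 (2000) (flows in Riemannian ambients).
-/

noncomputable section

-- the prescribed namespace repeats `SmoothPoincare4` (P = Sub)
set_option linter.dupNamespace false

open MeasureTheory Set Function
open scoped Manifold ContDiff ENNReal Topology BigOperators

namespace Summit.SmoothPoincare4.SmoothPoincare4.Cruxes.CylinderRungTwo.KillingFlux

open Literature.Geometry.Riemannian
open Literature.Geometry.Lorentzian Literature.Geometry.Lorentzian.PseudoRiemannianMetric
open Literature.Geometry.Riemannian.SphericalCylinderEntropy (cylEntropy)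
open Literature.Topology.FourManifolds
open Literature.Geometry.Manifold.CylinderSlice

local notation "E4" => EuclideanSpace ℝ (Fin 4)
local notation "E5" => EuclideanSpace ℝ (Fin 5)
local notation "E6" => EuclideanSpace ℝ (Fin 6)

set_option hygiene false in
local notation "S4" => Metric.sphere (0 : EuclideanSpace ℝ (Fin 5)) 1

set_option hygiene false in
local notation "S3" => Metric.sphere (0 : EuclideanSpace ℝ (Fin 4)) 1

attribute [local instance] fact_finrank_euclideanSpace_succ

/-! ## Smooth flows between two stopping times -/

/-- **A smooth mean curvature flow of embedded cross-sections of `N = S⁴ × ℝ` on a compact time interval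
`[T₀, T₁]`** — the clauses of `IsCylinderMCF` (joint smoothness on an open set of times containing the
interval; each slice a smooth embedding into `N`, an immersion for the Euclidean metric, with a smooth unit
normal tangent to `N`; velocity `∂F/∂t = -H_N ν` with `H_N` the tree's scalar `meanCurvature` of `(F t, ν t)`
in `ℝ⁶`), quantified over `t ∈ [T₀, T₁]`: the "finitely many smooth flows" between consecutive stopping
times of a flow with surgery (Daniels-Holgate, Def. 2.20), in the ambient `N`.
[cite: DanielsHolgate2022, §2.1 Def. 2.20] -/
structure IsCylinderMCFOn (M : Type) [TopologicalSpace M] [ChartedSpace E4 M] [IsManifold (𝓡 4) ∞ M]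
    (F : ℝ → M → E6) (ν : ℝ → M → E6) (T₀ T₁ : ℝ) : Prop where
  /-- The family is jointly smooth on `U × M` for some open `U ⊇ [T₀, T₁]`. -/
  contMDiffOn : ∃ U : Set ℝ, IsOpen U ∧ Set.Icc T₀ T₁ ⊆ U ∧
    ContMDiffOn (𝓘(ℝ, ℝ).prod (𝓡 4)) (𝓡 6) ∞ (fun p : ℝ × M => F p.1 p.2) (U ×ˢ Set.univ)
  /-- Each `F t`, `t ∈ [T₀, T₁]`, is a smooth embedding. -/
  isSmoothEmbedding : ∀ t ∈ Set.Icc T₀ T₁, Manifold.IsSmoothEmbedding (𝓡 4) (𝓡 6) ∞ (F t)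
  /-- Each `F t`, `t ∈ [T₀, T₁]`, lands in the cylinder `N`. -/
  mem_cyl : ∀ t ∈ Set.Icc T₀ T₁, ∀ x, ∑ i : Fin 5, F t x (Fin.castSucc i) ^ 2 = 1
  /-- Each `F t`, `t ∈ [T₀, T₁]`, is an immersion for the Euclidean metric of `ℝ⁶`. -/
  isSpacelikeImmersion : ∀ t ∈ Set.Icc T₀ T₁, (euclideanMetric E6).IsSpacelikeImmersion (𝓡 4) (F t)
  /-- `ν t` is a unit normal along `F t`. -/
  isUnitNormal : ∀ t ∈ Set.Icc T₀ T₁, (euclideanMetric E6).IsUnitNormal (𝓡 4) (F t) (ν t) 1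
  /-- `ν t x` is tangent to `N` at `F t x`. -/
  normal_tangent : ∀ t ∈ Set.Icc T₀ T₁, ∀ x, ∑ i : Fin 5, ν t x (Fin.castSucc i) * F t x (Fin.castSucc i) = 0
  /-- Each `ν t` is smooth. -/
  contMDiff_normal : ∀ t ∈ Set.Icc T₀ T₁, ContMDiff (𝓡 4) (𝓡 6) ∞ (ν t)
  /-- The flow equation `∂F/∂t = -H_N ν` on `[T₀, T₁]`. -/
  velocity_eq : ∀ t (ht : t ∈ Set.Icc T₀ T₁) (x : M),
    mfderiv 𝓘(ℝ, ℝ) (𝓡 6) (fun s => F s x) t (1 : ℝ) =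
      -((euclideanMetric E6).meanCurvature (F t) contMDiff_pullbackBilin_holds
          (isSpacelikeImmersion t ht) (ν t) x) • ν t x

/-- An immortal cylinder flow on `[T, ∞)` restricts to a cylinder flow on every `[T₀, T₁]` with `T ≤ T₀`.
[folklore] -/
theorem IsCylinderMCF.isCylinderMCFOn {M : Type} [TopologicalSpace M] [ChartedSpace E4 M]
    [IsManifold (𝓡 4) ∞ M] {F : ℝ → M → E6} {ν : ℝ → M → E6} {T : ℝ} (h : IsCylinderMCF M F ν T)
    {T₀ T₁ : ℝ} (h₀ : T ≤ T₀) : IsCylinderMCFOn M F ν T₀ T₁ := by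
  obtain ⟨U, hUo, hU, hUs⟩ := h.contMDiffOn
  exact
    { contMDiffOn := ⟨U, hUo, fun t ht => hU (Set.mem_Ici.2 (h₀.trans ht.1)), hUs⟩
      isSmoothEmbedding := fun t ht => h.isSmoothEmbedding t (h₀.trans ht.1)
      mem_cyl := fun t ht => h.mem_cyl t (h₀.trans ht.1)
      isSpacelikeImmersion := fun t ht => h.isSpacelikeImmersion t (h₀.trans ht.1)
      isUnitNormal := fun t ht => h.isUnitNormal t (h₀.trans ht.1)
      normal_tangent := fun t ht => h.normal_tangent t (h₀.trans ht.1)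
      contMDiff_normal := fun t ht => h.contMDiff_normal t (h₀.trans ht.1)
      velocity_eq := fun t ht x => h.velocity_eq t (h₀.trans ht.1) x }

/-- **Non-vacuity**: the static slice at height `c` with the upward normal `e₅` is a cylinder flow on every
`[T₀, T₁]` (restriction of the landed `isCylinderMCF_staticSlice`). [folklore] -/
theorem isCylinderMCFOn_staticSlice (c T₀ T₁ : ℝ) :
    IsCylinderMCFOn S4 (fun _ => sliceMap c) (fun _ _ => axis) T₀ T₁ :=
  (isCylinderMCF_staticSlice c T₀).isCylinderMCFOn le_rfl

/-! ## The flow with surgery along necks in the cylinder -/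

/-- **The slice `κ : M → ℝ⁶` at a stopping time of a mean curvature flow with neck surgery in
`N = S⁴ × ℝ ⊂ ℝ⁶` is resolved** — the cylinder analogue of the tree's Euclidean predicate
`Literature.Geometry.Riemannian.MCFNeckSurgeryResolvable` (the structure of the flow with surgery of
Daniels-Holgate, Thm. 1.3, in Haslhofer–Kleiner's formalism, Def. 2.18–2.20, 2.26, Thm. 2.29), with ONE MORE
kind of leaf: in `N` an end-separating component never vanishes (area floor `μH⁴ ≥ μH⁴(S⁴)`), so a flow with
surgery starting from a cross-section does not vanish in finite time — after the last stopping time the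
surviving components flow smoothly forever.  The smallest predicate on pairs (closed 4-manifold `M`, slice
`κ : M → ℝ⁶`) such that:
* `discard`: every slice of a discarded component (`IsMCFDiscardedComponent M`: `M ≅ S⁴` — in particular a
  component that becomes extinct at a round point — or `S³ × S¹`) is resolved;
* `flow`: if a smooth flow of embedded cross-sections `IsCylinderMCFOn M F ν T₀ T₁`, `T₀ < T₁`, runs from the
  slice `F T₀` and its final slice `F T₁` is resolved, then `F T₀` is resolved;
* `of_diffeomorph`: invariance under reparametrisation of the abstract manifold;
* `cut`: if `ψ : S³ × ℝ ↪ M` is a neck whose middle sphere separates `M` into the sides `D₁`, `D₂`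
  (`Literature.Topology.FourManifolds.NeckCapData`) and the two CANONICALLY CAPPED sides carry resolved slices,
  then `κ` is resolved (necks replaced by pairs of standard caps attached along the necks' product structure);
* `cutNonseparating`: the same for a non-separating neck, with the double cap
  `Literature.Topology.FourManifolds.DoubleCap.M`;
* `immortal` (NEW): if an immortal smooth flow `IsCylinderMCF M F ν T` of embedded cross-sections of the
  compact connected `M` runs from the slice `F T`, every slice separating the two ends of `N` with cylinder
  entropy `< 2`, then `F T` is resolved.
As in the Euclidean predicate, the geometry of necks and caps, the surgery parameters and the position of
the new slices relative to the old are forgotten; several necks replaced at one stopping time are successive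
cuts.  Non-vacuous: `cylNeckSurgeryResolvable_staticSlice`. [cite: DanielsHolgate2022, Thm. 1.3, §2.1 Def. 2.18–2.20, Def. 2.26, Thm. 2.29]
[cite: ChodoshMantoulidisSchulze2025, Cor. 1.5 (b)] -/
inductive CylNeckSurgeryResolvable :
    ∀ (M : Type) [TopologicalSpace M] [ChartedSpace E4 M], (M → E6) → Prop
  /-- Discarding: a slice of a discarded component (`≅ S⁴` or `S³ × S¹`) is resolved. -/
  | discard {M : Type} [TopologicalSpace M] [ChartedSpace E4 M]
      (hM : IsMCFDiscardedComponent M) (κ : M → E6) : CylNeckSurgeryResolvable M κ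
  /-- Flowing: a smooth flow of embedded cross-sections of `N` runs from the slice `F T₀` on `[T₀, T₁]`,
  `T₀ < T₁`, and its final slice `F T₁` is resolved. -/
  | flow {M : Type} [TopologicalSpace M] [T2Space M] [ChartedSpace E4 M]
      [IsManifold (𝓡 4) ∞ M] {F : ℝ → M → E6} {ν : ℝ → M → E6} {T₀ T₁ : ℝ} (hT : T₀ < T₁)
      (hF : IsCylinderMCFOn M F ν T₀ T₁)
      (h : CylNeckSurgeryResolvable M (F T₁)) : CylNeckSurgeryResolvable M (F T₀)
  /-- Reparametrisation: a slice is resolved with any reparametrisation `κ ∘ e⁻¹` of it by a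
  diffeomorphism `e : M ≅ M'` of the abstract manifold (the same cross-section of `N`). -/
  | of_diffeomorph {M M' : Type} [TopologicalSpace M] [ChartedSpace E4 M]
      [TopologicalSpace M'] [ChartedSpace E4 M'] [IsManifold (𝓡 4) ∞ M'] {κ : M → E6}
      (h : CylNeckSurgeryResolvable M κ) (e : M ≃ₘ⟮𝓡 4, 𝓡 4⟯ M') :
      CylNeckSurgeryResolvable M' (κ ∘ e.symm)
  /-- Surgery on a separating neck: the neck `ψ` is cut at its middle sphere and its two sides are capped
  canonically; both capped sides, with their new slices, are resolved. -/
  | cut {M : Type} [TopologicalSpace M] [T2Space M] [ChartedSpace E4 M]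
      [IsManifold (𝓡 4) ∞ M] (κ : M → E6) {ψ : (S3) × ℝ → M} (D₁ : NeckCapData 3 ψ)
      (D₂ : NeckCapData 3 (fun q : (S3) × ℝ => ψ (q.1, -q.2)))
      (hdisj : Disjoint (D₁.side : Set M) D₂.side)
      (hcover : ∀ p : M, p ∉ D₁.side → p ∉ D₂.side → ∃ θ : S3, ψ (θ, 0) = p)
      (κ₁ : D₁.Capped → E6) (κ₂ : D₂.Capped → E6)
      (h₁ : CylNeckSurgeryResolvable D₁.Capped κ₁) (h₂ : CylNeckSurgeryResolvable D₂.Capped κ₂) :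
      CylNeckSurgeryResolvable M κ
  /-- Surgery on a non-separating neck: the neck is cut at its middle sphere and both ends are capped
  canonically (the double cap); the capped manifold, with its new slice, is resolved. -/
  | cutNonseparating {M : Type} [TopologicalSpace M] [T2Space M] [ChartedSpace E4 M]
      [IsManifold (𝓡 4) ∞ M] (κ : M → E6) {ψ : (S3) × ℝ → M}
      (hψ : Manifold.IsSmoothEmbedding ((𝓡 3).prod 𝓘(ℝ, ℝ)) (𝓡 4) ∞ ψ) (hψo : IsOpen (range ψ))
      (hns : IsPreconnected (ψ '' (univ ×ˢ ({0} : Set ℝ)))ᶜ)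
      (κ' : DoubleCap.M hψ hψo → E6) (h : CylNeckSurgeryResolvable (DoubleCap.M hψ hψo) κ') :
      CylNeckSurgeryResolvable M κ
  /-- Immortality (the new leaf): an immortal smooth flow of embedded cross-sections of the compact connected
  `M` runs from the slice `F T`, every slice separating the ends with cylinder entropy `< 2`. -/
  | immortal {M : Type} [TopologicalSpace M] [T2Space M] [SecondCountableTopology M]
      [ChartedSpace E4 M] [IsManifold (𝓡 4) ∞ M] [CompactSpace M] [ConnectedSpace M]
      {F : ℝ → M → E6} {ν : ℝ → M → E6} {T : ℝ} (hF : IsCylinderMCF M F ν T)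
      (hsep : ∀ t, T ≤ t → SeparatesEnds (Set.range (F t)))
      (hthin : ∀ t, T ≤ t → cylEntropy (Set.range (F t)) < 2) :
      CylNeckSurgeryResolvable M (F T)

/-! ## Non-vacuity of the interface -/

/-- Every slice of a manifold diffeomorphic to `S⁴` is resolved (it is a discarded component).
[cite: DanielsHolgate2022, Thm. 2.29] -/
theorem CylNeckSurgeryResolvable.of_nonempty_diffeomorph_sphere {M : Type} [TopologicalSpace M]
    [ChartedSpace E4 M] (h : Nonempty (M ≃ₘ⟮𝓡 4, 𝓡 4⟯ S4)) (κ : M → E6) :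
    CylNeckSurgeryResolvable M κ :=
  .discard (IsMCFDiscardedComponent.of_nonempty_diffeomorph_sphere h) κ

/-- The `flow` constructor with the initial slice named. [cite: DanielsHolgate2022, §2.1 Def. 2.20] -/
theorem CylNeckSurgeryResolvable.flow_of_eq {M : Type} [TopologicalSpace M] [T2Space M]
    [ChartedSpace E4 M] [IsManifold (𝓡 4) ∞ M] {F : ℝ → M → E6} {ν : ℝ → M → E6} {T₀ T₁ : ℝ}
    {κ : M → E6} (hT : T₀ < T₁) (hF : IsCylinderMCFOn M F ν T₀ T₁) (h0 : F T₀ = κ)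
    (h : CylNeckSurgeryResolvable M (F T₁)) : CylNeckSurgeryResolvable M κ :=
  h0 ▸ CylNeckSurgeryResolvable.flow hT hF h

/-- The `immortal` constructor with the initial slice named. [folklore] -/
theorem CylNeckSurgeryResolvable.immortal_of_eq {M : Type} [TopologicalSpace M] [T2Space M]
    [SecondCountableTopology M] [ChartedSpace E4 M] [IsManifold (𝓡 4) ∞ M] [CompactSpace M]
    [ConnectedSpace M] {F : ℝ → M → E6} {ν : ℝ → M → E6} {T : ℝ} {κ : M → E6}
    (hF : IsCylinderMCF M F ν T) (hsep : ∀ t, T ≤ t → SeparatesEnds (Set.range (F t)))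
    (hthin : ∀ t, T ≤ t → cylEntropy (Set.range (F t)) < 2) (h0 : F T = κ) :
    CylNeckSurgeryResolvable M κ :=
  h0 ▸ CylNeckSurgeryResolvable.immortal hF hsep hthin

/-- **The `immortal` leaf is inhabited**: the static slice flow of `S⁴` at height `c` (landed
`isCylinderMCF_staticSlice`) separates the ends (`separatesEnds_of_slice_subset`) and has cylinder entropy
`≤ 1 < 2` at all times (landed calibration `cylEntropy_range_sliceMap_le_one`), so the slice
`sliceMap c : S⁴ → N` is resolved. [folklore] -/
theorem cylNeckSurgeryResolvable_staticSlice (c : ℝ) : CylNeckSurgeryResolvable S4 (sliceMap c) := by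
  haveI : CompactSpace S4 := isCompact_iff_compactSpace.1 (isCompact_sphere _ _)
  haveI : ConnectedSpace S4 := by
    haveI := Literature.Topology.FourManifolds.pathConnectedSpace_sphere_four
    infer_instance
  refine CylNeckSurgeryResolvable.immortal_of_eq (isCylinderMCF_staticSlice c 0) (fun t _ => ?_)
    (fun t _ => ?_) rfl
  · exact separatesEnds_of_slice_subset (by rw [range_sliceMap])
  · exact (FiniteTimeHalfOfCrux.cylEntropy_range_sliceMap_le_one c).trans_lt ENNReal.one_lt_two

/-- The `flow` constructor is inhabited too: flowing the slice statically on `[0, 1]` and then declaring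
it immortal resolves it (exercise of `flow` ∘ `immortal` on the static slice). [folklore] -/
theorem cylNeckSurgeryResolvable_staticSlice_flow (c : ℝ) : CylNeckSurgeryResolvable S4 (sliceMap c) :=
  CylNeckSurgeryResolvable.flow_of_eq (F := fun _ => sliceMap c) (ν := fun _ _ => axis) one_pos
    (isCylinderMCFOn_staticSlice c 0 1) rfl (cylNeckSurgeryResolvable_staticSlice c)

/-- **Registered anchor `stub_cylNeckSurgeryResolvable_staticSlice` (non-vacuity of the surgery interface).**
For every height `c`, the slice `sliceMap c : S⁴ → N` is resolved in the sense of
`CylNeckSurgeryResolvable` (it is the initial slice of the immortal static slice flow, an `immortal` leaf).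
This is the registered stub through which this vocabulary file lands `--supports stmt-SmoothPoincare4-7631`.
[folklore] -/
theorem stub_cylNeckSurgeryResolvable_staticSlice :
    ∀ c : ℝ, CylNeckSurgeryResolvable (Metric.sphere (0 : EuclideanSpace ℝ (Fin 5)) 1)
      (Literature.Geometry.Manifold.CylinderSlice.sliceMap c) :=
  fun c => cylNeckSurgeryResolvable_staticSlice c

end Summit.SmoothPoincare4.SmoothPoincare4.Cruxes.CylinderRungTwo.KillingFlux

end
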